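import Summits.QuantumFields.BalabanUV.Beta.GAN24.WardResidualRotatedVertexWeighted
import Summits.QuantumFields.BalabanUV.Beta.GAN24.GaugeReadChargeProfile
import Summits.QuantumFields.BalabanUV.Beta.GAN24.TaylorTrilinearLattice

/-!
# `BalabanUV.Beta.GAN24.SlotChargeProfileEnvelope` — binder row G-an2-4 ∕ (CONV-C), W-slot CT-W, route «WC-TL» ∕ «QR-LL», row **(LT-Δ) «LAYER TRANSPORT»**, junction (LT-J1):
# **THE SLOT-CHARGE PROFILE ENVELOPE** — the `hZ` binder of the (G)∕(LT-3) sockets (`LayerFrozenLabel.abs_frozen_label_le`, `LayerFrozenCount.abs_cubic_frozen_le`,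
# `LayerTransportLedger`, `LayerTransportBiLoc`: `|Z_y e| ≤ B·e^{−δZ‖e − y‖₁}`, label `y`, slot `e`) FOR PROFILES OF p2's `V_Z` SHAPE
# (`WardResidualRotatedVertexWeighted.hasSum_weighted_rotatedVertex_comb`, `WardResidualRotatedVertexTransported` §1): column decay × the label weights × bounded pair charges

NOT IN PRINT; OUR BOOKKEEPING ([folklore] lattice real analysis BY NAME: `TaylorTrilinearLattice.l1_quo_sub_quo_le` (block labels are 1-Lipschitz), `ExpKernelCalculus.l1_natSmul`,
`summable_exp_shift' ∕ tsum_exp_shift'`, Mathlib's `tsum_of_norm_bounded`, leaf-06's `GaugeReadChargeProfile.biLoc_weightMul` (p324652 ✓) ⨾ `GaugeReadChargeDipole.abs_tsum_prod_le_of_biLoc`; G-an2-4 formalisation swarm, leaf prover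
`b2b-balaban-gan24-formalise-leaf-01`, gen 65, INTENT I-leaf01-g65-1).  HONEST FRAMING (cell contract, verbatim): «discharging `BetaPertH` makes Bałaban's UV stability UNCONDITIONAL —
a real constructive-QFT result; it is NOT the continuum limit and NOT the Clay problem.»  HONEST DEPENDENCY (verbatim): «continuum YM on T⁴ ⇐ BetaPertH ∧ nine spine estimates (0/9
proved); BetaPertH ⇐ (D1) ∧ (D4) ∧ CAP+tail; G-an2-4 gates asym, D1 and NE2/3/4.»

## What (generic `d`; §1–§2: generic blocking `N ≥ 1`, a kernel `K′` given ONLY through its column envelopes, generic bounded charges — no object of an2's typed system)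
§1 THE TWO LABEL-WEIGHT FACTS: `|½𝟙[y′=y] − ½𝟙[blk N u = y]| ≤ ½` and «weight ≠ 0 ⇒ ‖y′ − y‖₁ ≤ ‖u − N•y′‖₁» (inside the block of `y` the label distance is a block-label
   distance, and block labels move no faster than sites), hence `|weight|·e^{−m‖u − N•y′‖₁} ≤ ½·e^{−(m∕2)‖u − N•y′‖₁}·e^{−(m∕2)‖y′ − y‖₁}` — half the column rate goes to slot
   summability, half to the label envelope, NO block factor `e^{m(d+1)(N−1)}`; the multiplier twins with `½𝟙[y′=y] − ½𝟙[w=y]` and `‖w − y′‖₁ ≤ ‖N•w − N•y′‖₁`.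
§2 **`abs_slotProfile_le`** — for `|colH K′ N ν y′ κ u| ≤ C′·e^{−m‖u − N•y′‖₁}`, `|colM K′ N ν y′ ρ w| ≤ C′·e^{−m‖N•w − N•y′‖₁}` (`m > 0`; `abs_colH_le ∕ abs_colM_le` of a
   `Decays` kernel) and bounded charges `|ZS κ u| ≤ zS`, `|ZM ρ w| ≤ zM`:
   `|½·(Σ_κ Σ'_u colH·(½𝟙[y′=y] − ½𝟙[blk N u = y])·ZS κ u + Σ_ρ Σ'_w colM·(½𝟙[y′=y] − ½𝟙[w=y])·ZM ρ w)| ≤ ¼·(d+1)·C′·(zS + zM)·Zl(m∕2)·e^{−(m∕2)‖y′ − y‖₁}`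
   — the `hZ` shape with `B = ¼(d+1)C′(zS+zM)Zl(m∕2)`, `δZ = m∕2`; the slot series' summability (`abs_tsum_colH_weight_le ∕ abs_tsum_colM_weight_le`); and
   `abs_weightedCharge_le_of_biLoc` (`|Σ'_{(x,z)} ω·K x z a b| ≤ Bω·C·Zl(δ)²`), so `zS ∕ zM` come from `LocStencil S` ∕ `VertexFamily M` and `|ω| ≤ Bω`
   (`abs_weightedCharge_le_of_locStencil ∕ _of_vertexFamily`).
§3 THE COMB SHAPE, HYPOTHESES DISPLAYED (**no `j`-uniformity claimed** — the decay constants of `G_{j+1}`, `S_{j+1}`, `M1_{j+1}` enter as NAMED hypotheses; the tree's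
   `decays_coDressKBmAt_KInvStep` ∕ `locStencil_SpureRecAt` ∕ `vertexFamily_M1At` are existential PER `j`, the UNIT-currency constants are the (S)-row assembly's):
   **`abs_transportedProfile_le`** — the value `V y′` of `WardResidualRotatedVertexTransported.hasSum_prod_transported_rotatedVertex_comb` (label `y`, slot `(ν, y′)`, channel
   `(α, β)`, scalar `−Lc²σ_{j+1}²` included) obeys `|V y′| ≤ B_α·e^{−(δG∕2)‖y′ − y‖₁}` for EVERY `y′`, `B_α` displayed — LITERALLY the `hZ` of the (G) socket for the (α)-piece
   (XREAD C-gan24leaf01-g65-1 (J1)); `exists_transportedProfile_envelope` (the per-`j` existential form on the tree's decay lemmas).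
NOT typed here: (INV)∕(Π) (p2∕leaf-06∕the OWNER's `SlotMomentParity`), (S-β), any `j`-uniform constant, the legs.  [folklore]; 0 cited facts, 0 `def`, 0 `def … : Prop`, 0 sorry.
Asserts NO value of any charge; NOTHING of (S)∕(Q-R)∕(LT)∕(Q-L)∕(C)∕«T2Shape»∕«T2Drift»∕(hW, hWall) discharged; NEVER «G-an2-4 closed» as (CONV-C); NOT D1, NOT `BetaPertH`, NOT continuum,
NOT Clay.  2026-08-22; no existing file touched.
-/

noncomputable section

open Finset
open scoped BigOperators
open Literature.MathematicalPhysics.QuantumFieldTheory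
open Literature.MathematicalPhysics.QuantumFieldTheory.Balaban1983to89
open Literature.MathematicalPhysics.QuantumFieldTheory.Balaban1983to89.Beta
open B12Sec2to5 (l1 l1_nonneg)
open ExpKernelCalculus (Site MKer BiLoc Decays VertexFamily Zl Zl_nonneg Zl_pos l1_sub_symm l1_natSmul summable_exp_shift' tsum_exp_shift')
open AffineAveraging (box toSite)
open AveragingContours (blk)
open LatticeForm (quo)
open OneStepResolventKernel (Fib LocStencil quo_zsmul)
open OneStepKernelFamily (KInvStep colH abs_colH_le)
open SecondOrderResponse (colM abs_colM_le)
open Summit.QuantumFields.BalabanUV.Beta.AxialDressingRooted (coDressKBmAt decays_coDressKBmAt_KInvStep)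
open Summit.QuantumFields.BalabanUV.Beta.SpineRooted (SpureRecAt M1At locStencil_SpureRecAt vertexFamily_M1At)
open Summit.QuantumFields.BalabanUV.Beta.GAN24.TaylorTrilinearLattice (l1_quo_sub_quo_le)
open Summit.QuantumFields.BalabanUV.Beta.GAN24.GaugeReadChargeDipole (abs_tsum_prod_le_of_biLoc)
open Summit.QuantumFields.BalabanUV.Beta.GAN24.GaugeReadChargeProfile (biLoc_weightMul)

namespace Summit.QuantumFields.BalabanUV.Beta.GAN24.SlotChargeProfileEnvelope

variable {d : ℕ}

/-! ## §1 The two label-weight facts -/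

/-- [folklore] The field-side label weight `½𝟙[y′=y] − ½𝟙[blk N u = y]` is bounded by `½`. -/
theorem abs_weightH_le (N : ℕ) (y y' u : Site (d + 1)) :
    |((if y' = y then (1 / 2 : ℝ) else 0) - (if blk N u = y then (1 / 2 : ℝ) else 0))| ≤ 1 / 2 := by
  split_ifs <;> norm_num

/-- [folklore] The multiplier-side label weight `½𝟙[y′=y] − ½𝟙[w=y]` is bounded by `½`. -/
theorem abs_weightM_le (y y' w : Site (d + 1)) :
    |((if y' = y then (1 / 2 : ℝ) else 0) - (if w = y then (1 / 2 : ℝ) else 0))| ≤ 1 / 2 := by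
  split_ifs <;> norm_num

/-- [folklore] `‖0‖₁ = 0` on the site lattice. -/
theorem l1_zero_site : l1 (0 : Site (d + 1)) = 0 := by
  simp [l1]

/-- [folklore] **WHERE THE FIELD-SIDE WEIGHT LIVES**: if `½𝟙[y′=y] − ½𝟙[blk N u = y] ≠ 0` then `‖y′ − y‖₁ ≤ ‖u − N•y′‖₁` (either `y′ = y`, or `u` lies in the block of
`y`, where `‖y − y′‖₁ = ‖quo N u − quo N (N•y′)‖₁ ≤ ‖u − N•y′‖₁` — block labels move no faster than sites, `TaylorTrilinearLattice.l1_quo_sub_quo_le`). -/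
theorem l1_le_of_weightH_ne_zero {N : ℕ} (hN : 1 ≤ N) {y y' u : Site (d + 1)}
    (h : ((if y' = y then (1 / 2 : ℝ) else 0) - (if blk N u = y then (1 / 2 : ℝ) else 0)) ≠ 0) :
    l1 (y' - y) ≤ l1 (u - (N : ℤ) • y') := by
  haveI : NeZero N := ⟨by omega⟩
  by_cases hy : y' = y
  · rw [hy, sub_self, l1_zero_site]
    exact l1_nonneg _
  · by_cases hu : blk N u = y
    · have hq : quo N u = y := hu
      have h1 := l1_quo_sub_quo_le N ((N : ℤ) • y') u
      rw [quo_zsmul (N := N), hq] at h1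
      rwa [l1_sub_symm u]
    · exact absurd (by simp [hy, hu]) h

/-- [folklore] **WHERE THE MULTIPLIER-SIDE WEIGHT LIVES**: if `½𝟙[y′=y] − ½𝟙[w=y] ≠ 0` then `‖y′ − y‖₁ ≤ ‖w − y′‖₁`. -/
theorem l1_le_of_weightM_ne_zero {y y' w : Site (d + 1)}
    (h : ((if y' = y then (1 / 2 : ℝ) else 0) - (if w = y then (1 / 2 : ℝ) else 0)) ≠ 0) :
    l1 (y' - y) ≤ l1 (w - y') := by
  by_cases hy : y' = y
  · rw [hy, sub_self, l1_zero_site]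
    exact l1_nonneg _
  · by_cases hw : w = y
    · rw [hw, l1_sub_symm]
    · exact absurd (by simp [hy, hw]) h

/-- [folklore] Coarse sites are at least as far apart as their labels: `‖w − y′‖₁ ≤ ‖N•w − N•y′‖₁` for `N ≥ 1`. -/
theorem l1_sub_le_l1_zsmul_sub {N : ℕ} (hN : 1 ≤ N) (w y' : Site (d + 1)) :
    l1 (w - y') ≤ l1 ((N : ℤ) • w - (N : ℤ) • y') := by
  rw [← smul_sub, l1_natSmul]
  exact le_mul_of_one_le_left (l1_nonneg _) (by exact_mod_cast hN)

/-- [folklore] **THE FIELD-SIDE WEIGHT SPLITS THE COLUMN RATE**: `|½𝟙[y′=y] − ½𝟙[blk N u = y]|·e^{−m‖u − N•y′‖₁} ≤ ½·e^{−(m∕2)‖u − N•y′‖₁}·e^{−(m∕2)‖y′ − y‖₁}`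
(`N ≥ 1`, `m ≥ 0`) — half the rate for slot summability, half for the label envelope; no block factor. -/
theorem abs_weightH_mul_exp_le {N : ℕ} (hN : 1 ≤ N) {m : ℝ} (hm : 0 ≤ m) (y y' u : Site (d + 1)) :
    |((if y' = y then (1 / 2 : ℝ) else 0) - (if blk N u = y then (1 / 2 : ℝ) else 0))| * Real.exp (-m * l1 (u - (N : ℤ) • y'))
      ≤ (1 / 2) * (Real.exp (-(m / 2) * l1 (u - (N : ℤ) • y')) * Real.exp (-(m / 2) * l1 (y' - y))) := by
  by_cases h : ((if y' = y then (1 / 2 : ℝ) else 0) - (if blk N u = y then (1 / 2 : ℝ) else 0)) = 0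
  · rw [h, abs_zero, zero_mul]
    positivity
  · have hl := l1_le_of_weightH_ne_zero hN h
    have he : Real.exp (-m * l1 (u - (N : ℤ) • y'))
        ≤ Real.exp (-(m / 2) * l1 (u - (N : ℤ) • y')) * Real.exp (-(m / 2) * l1 (y' - y)) := by
      rw [← Real.exp_add]
      exact Real.exp_le_exp.2 (by nlinarith [mul_nonneg hm (sub_nonneg.2 hl)])
    exact mul_le_mul (abs_weightH_le N y y' u) he (Real.exp_pos _).le (by norm_num)

/-- [folklore] **THE MULTIPLIER-SIDE WEIGHT SPLITS THE COLUMN RATE**: `|½𝟙[y′=y] − ½𝟙[w=y]|·e^{−m‖N•w − N•y′‖₁} ≤ ½·e^{−(m∕2)‖w − y′‖₁}·e^{−(m∕2)‖y′ − y‖₁}`. -/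
theorem abs_weightM_mul_exp_le {N : ℕ} (hN : 1 ≤ N) {m : ℝ} (hm : 0 ≤ m) (y y' w : Site (d + 1)) :
    |((if y' = y then (1 / 2 : ℝ) else 0) - (if w = y then (1 / 2 : ℝ) else 0))| * Real.exp (-m * l1 ((N : ℤ) • w - (N : ℤ) • y'))
      ≤ (1 / 2) * (Real.exp (-(m / 2) * l1 (w - y')) * Real.exp (-(m / 2) * l1 (y' - y))) := by
  have hNw := l1_sub_le_l1_zsmul_sub hN w y'
  by_cases h : ((if y' = y then (1 / 2 : ℝ) else 0) - (if w = y then (1 / 2 : ℝ) else 0)) = 0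
  · rw [h, abs_zero, zero_mul]
    positivity
  · have hl := l1_le_of_weightM_ne_zero h
    have he : Real.exp (-m * l1 ((N : ℤ) • w - (N : ℤ) • y'))
        ≤ Real.exp (-(m / 2) * l1 (w - y')) * Real.exp (-(m / 2) * l1 (y' - y)) := by
      rw [← Real.exp_add]
      exact Real.exp_le_exp.2 (by nlinarith [mul_nonneg hm (sub_nonneg.2 hl), mul_nonneg hm (sub_nonneg.2 hNw)])
    exact mul_le_mul (abs_weightM_le y y' w) he (Real.exp_pos _).le (by norm_num)

/-! ## §2 The envelope of a `V_Z`-shaped slot-charge profile -/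

section Generic

variable {K' : MKer (d + 1) (Fib d)} {N : ℕ} {C' m zS zM : ℝ}
  {ZS ZM : Fin (d + 1) → Site (d + 1) → ℝ}

/-- [folklore] **THE FIELD-SIDE SLOT SERIES**: summable, and `|Σ'_u colH K′ N ν y′ κ u·(½𝟙[y′=y] − ½𝟙[blk N u = y])·ZS κ u| ≤ ½·C′·zS·Zl(m∕2)·e^{−(m∕2)‖y′ − y‖₁}`. -/
theorem abs_tsum_colH_weight_le (hN : 1 ≤ N) (hm : 0 < m) (hC' : 0 ≤ C') (hzS : 0 ≤ zS) (ν κ : Fin (d + 1)) (y y' : Site (d + 1))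
    (hH : ∀ u, |colH K' N ν y' κ u| ≤ C' * Real.exp (-m * l1 (u - (N : ℤ) • y'))) (hZS : ∀ u, |ZS κ u| ≤ zS) :
    Summable (fun u : Site (d + 1) =>
        colH K' N ν y' κ u * ((if y' = y then (1 / 2 : ℝ) else 0) - (if blk N u = y then (1 / 2 : ℝ) else 0)) * ZS κ u) ∧
      |∑' u : Site (d + 1),
          colH K' N ν y' κ u * ((if y' = y then (1 / 2 : ℝ) else 0) - (if blk N u = y then (1 / 2 : ℝ) else 0)) * ZS κ u|
        ≤ (1 / 2) * C' * zS * Zl (d + 1) (m / 2) * Real.exp (-(m / 2) * l1 (y' - y)) := by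
  set E : ℝ := Real.exp (-(m / 2) * l1 (y' - y)) with hE
  have hg : HasSum (fun u : Site (d + 1) => (1 / 2) * C' * zS * E * Real.exp (-(m / 2) * l1 (u - (N : ℤ) • y')))
      ((1 / 2) * C' * zS * E * Zl (d + 1) (m / 2)) := by
    have h := (summable_exp_shift' (half_pos hm) ((N : ℤ) • y')).hasSum
    rw [tsum_exp_shift'] at h
    exact h.mul_left _
  have hle : ∀ u : Site (d + 1),
      ‖colH K' N ν y' κ u * ((if y' = y then (1 / 2 : ℝ) else 0) - (if blk N u = y then (1 / 2 : ℝ) else 0)) * ZS κ u‖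
        ≤ (1 / 2) * C' * zS * E * Real.exp (-(m / 2) * l1 (u - (N : ℤ) • y')) := by
    intro u
    set wt : ℝ := (if y' = y then (1 / 2 : ℝ) else 0) - (if blk N u = y then (1 / 2 : ℝ) else 0) with hwt
    rw [Real.norm_eq_abs, abs_mul, abs_mul]
    have h1 : |wt| * Real.exp (-m * l1 (u - (N : ℤ) • y'))
        ≤ (1 / 2) * (Real.exp (-(m / 2) * l1 (u - (N : ℤ) • y')) * E) := by
      rw [hwt, hE]; exact abs_weightH_mul_exp_le hN hm.le y y' u
    have h2 : |colH K' N ν y' κ u| * |wt| ≤ C' * Real.exp (-m * l1 (u - (N : ℤ) • y')) * |wt| :=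
      mul_le_mul_of_nonneg_right (hH u) (abs_nonneg _)
    calc |colH K' N ν y' κ u| * |wt| * |ZS κ u| ≤ C' * Real.exp (-m * l1 (u - (N : ℤ) • y')) * |wt| * zS :=
          mul_le_mul h2 (hZS u) (abs_nonneg _) (by positivity)
      _ = C' * zS * (|wt| * Real.exp (-m * l1 (u - (N : ℤ) • y'))) := by ring
      _ ≤ C' * zS * ((1 / 2) * (Real.exp (-(m / 2) * l1 (u - (N : ℤ) • y')) * E)) :=
          mul_le_mul_of_nonneg_left h1 (mul_nonneg hC' hzS)
      _ = (1 / 2) * C' * zS * E * Real.exp (-(m / 2) * l1 (u - (N : ℤ) • y')) := by ring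
  refine ⟨hg.summable.of_norm_bounded hle, ?_⟩
  have h := tsum_of_norm_bounded hg hle
  rw [Real.norm_eq_abs] at h
  calc _ ≤ (1 / 2) * C' * zS * E * Zl (d + 1) (m / 2) := h
    _ = (1 / 2) * C' * zS * Zl (d + 1) (m / 2) * E := by ring

/-- [folklore] **THE MULTIPLIER-SIDE SLOT SERIES**: summable, and `|Σ'_w colM K′ N ν y′ ρ w·(½𝟙[y′=y] − ½𝟙[w=y])·ZM ρ w| ≤ ½·C′·zM·Zl(m∕2)·e^{−(m∕2)‖y′ − y‖₁}`. -/
theorem abs_tsum_colM_weight_le (hN : 1 ≤ N) (hm : 0 < m) (hC' : 0 ≤ C') (hzM : 0 ≤ zM) (ν ρ : Fin (d + 1)) (y y' : Site (d + 1))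
    (hM : ∀ w, |colM K' N ν y' ρ w| ≤ C' * Real.exp (-m * l1 ((N : ℤ) • w - (N : ℤ) • y'))) (hZM : ∀ w, |ZM ρ w| ≤ zM) :
    Summable (fun w : Site (d + 1) =>
        colM K' N ν y' ρ w * ((if y' = y then (1 / 2 : ℝ) else 0) - (if w = y then (1 / 2 : ℝ) else 0)) * ZM ρ w) ∧
      |∑' w : Site (d + 1),
          colM K' N ν y' ρ w * ((if y' = y then (1 / 2 : ℝ) else 0) - (if w = y then (1 / 2 : ℝ) else 0)) * ZM ρ w|
        ≤ (1 / 2) * C' * zM * Zl (d + 1) (m / 2) * Real.exp (-(m / 2) * l1 (y' - y)) := by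
  set E : ℝ := Real.exp (-(m / 2) * l1 (y' - y)) with hE
  have hg : HasSum (fun w : Site (d + 1) => (1 / 2) * C' * zM * E * Real.exp (-(m / 2) * l1 (w - y')))
      ((1 / 2) * C' * zM * E * Zl (d + 1) (m / 2)) := by
    have h := (summable_exp_shift' (half_pos hm) y').hasSum
    rw [tsum_exp_shift'] at h
    exact h.mul_left _
  have hle : ∀ w : Site (d + 1),
      ‖colM K' N ν y' ρ w * ((if y' = y then (1 / 2 : ℝ) else 0) - (if w = y then (1 / 2 : ℝ) else 0)) * ZM ρ w‖
        ≤ (1 / 2) * C' * zM * E * Real.exp (-(m / 2) * l1 (w - y')) := by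
    intro w
    set wt : ℝ := (if y' = y then (1 / 2 : ℝ) else 0) - (if w = y then (1 / 2 : ℝ) else 0) with hwt
    rw [Real.norm_eq_abs, abs_mul, abs_mul]
    have h1 : |wt| * Real.exp (-m * l1 ((N : ℤ) • w - (N : ℤ) • y'))
        ≤ (1 / 2) * (Real.exp (-(m / 2) * l1 (w - y')) * E) := by
      rw [hwt, hE]; exact abs_weightM_mul_exp_le hN hm.le y y' w
    have h2 : |colM K' N ν y' ρ w| * |wt| ≤ C' * Real.exp (-m * l1 ((N : ℤ) • w - (N : ℤ) • y')) * |wt| :=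
      mul_le_mul_of_nonneg_right (hM w) (abs_nonneg _)
    calc |colM K' N ν y' ρ w| * |wt| * |ZM ρ w| ≤ C' * Real.exp (-m * l1 ((N : ℤ) • w - (N : ℤ) • y')) * |wt| * zM :=
          mul_le_mul h2 (hZM w) (abs_nonneg _) (by positivity)
      _ = C' * zM * (|wt| * Real.exp (-m * l1 ((N : ℤ) • w - (N : ℤ) • y'))) := by ring
      _ ≤ C' * zM * ((1 / 2) * (Real.exp (-(m / 2) * l1 (w - y')) * E)) :=
          mul_le_mul_of_nonneg_left h1 (mul_nonneg hC' hzM)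
      _ = (1 / 2) * C' * zM * E * Real.exp (-(m / 2) * l1 (w - y')) := by ring
  refine ⟨hg.summable.of_norm_bounded hle, ?_⟩
  have h := tsum_of_norm_bounded hg hle
  rw [Real.norm_eq_abs] at h
  calc _ ≤ (1 / 2) * C' * zM * E * Zl (d + 1) (m / 2) := h
    _ = (1 / 2) * C' * zM * Zl (d + 1) (m / 2) * E := by ring

/-- NOT IN PRINT; OUR BOOKKEEPING.  **THE ENVELOPE OF A `V_Z`-SHAPED SLOT-CHARGE PROFILE** (the `hZ` binder of the (G)∕(LT-3) sockets): for a kernel `K′` whose `(ν, y′)`-columns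
decay from the coarse point `N•y′` at rate `m > 0` with constant `C′` (field rows `colH`, multiplier rows `colM`) and bounded charges `|ZS κ u| ≤ zS`, `|ZM ρ w| ≤ zM`, the profile
`y′ ↦ ½·(Σ_κ Σ'_u colH K′ N ν y′ κ u·(½𝟙[y′=y] − ½𝟙[blk N u = y])·ZS κ u + Σ_ρ Σ'_w colM K′ N ν y′ ρ w·(½𝟙[y′=y] − ½𝟙[w=y])·ZM ρ w)` — p2's `V_Z` at label `y` — satisfies
`|V_Z y′| ≤ ¼·(d+1)·C′·(zS + zM)·Zl(m∕2)·e^{−(m∕2)‖y′ − y‖₁}` for every slot `y′`. -/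
theorem abs_slotProfile_le (hN : 1 ≤ N) (hm : 0 < m) (hC' : 0 ≤ C') (hzS : 0 ≤ zS) (hzM : 0 ≤ zM) (ν : Fin (d + 1)) (y y' : Site (d + 1))
    (hH : ∀ κ u, |colH K' N ν y' κ u| ≤ C' * Real.exp (-m * l1 (u - (N : ℤ) • y')))
    (hM : ∀ ρ w, |colM K' N ν y' ρ w| ≤ C' * Real.exp (-m * l1 ((N : ℤ) • w - (N : ℤ) • y')))
    (hZS : ∀ κ u, |ZS κ u| ≤ zS) (hZM : ∀ ρ w, |ZM ρ w| ≤ zM) :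
    |(1 / 2 : ℝ) *
        ((∑ κ : Fin (d + 1), ∑' u : Site (d + 1),
            colH K' N ν y' κ u * ((if y' = y then (1 / 2 : ℝ) else 0) - (if blk N u = y then (1 / 2 : ℝ) else 0)) * ZS κ u)
          + ∑ ρ : Fin (d + 1), ∑' w : Site (d + 1),
            colM K' N ν y' ρ w * ((if y' = y then (1 / 2 : ℝ) else 0) - (if w = y then (1 / 2 : ℝ) else 0)) * ZM ρ w)|
      ≤ (1 / 4) * ((d : ℝ) + 1) * C' * (zS + zM) * Zl (d + 1) (m / 2) * Real.exp (-(m / 2) * l1 (y' - y)) := by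
  set E : ℝ := Real.exp (-(m / 2) * l1 (y' - y)) with hE
  have hHs : ∀ κ : Fin (d + 1), |∑' u : Site (d + 1),
      colH K' N ν y' κ u * ((if y' = y then (1 / 2 : ℝ) else 0) - (if blk N u = y then (1 / 2 : ℝ) else 0)) * ZS κ u|
        ≤ (1 / 2) * C' * zS * Zl (d + 1) (m / 2) * E :=
    fun κ => (abs_tsum_colH_weight_le hN hm hC' hzS ν κ y y' (hH κ) (hZS κ)).2
  have hMs : ∀ ρ : Fin (d + 1), |∑' w : Site (d + 1),
      colM K' N ν y' ρ w * ((if y' = y then (1 / 2 : ℝ) else 0) - (if w = y then (1 / 2 : ℝ) else 0)) * ZM ρ w|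
        ≤ (1 / 2) * C' * zM * Zl (d + 1) (m / 2) * E :=
    fun ρ => (abs_tsum_colM_weight_le hN hm hC' hzM ν ρ y y' (hM ρ) (hZM ρ)).2
  have hsumH : |∑ κ : Fin (d + 1), ∑' u : Site (d + 1),
      colH K' N ν y' κ u * ((if y' = y then (1 / 2 : ℝ) else 0) - (if blk N u = y then (1 / 2 : ℝ) else 0)) * ZS κ u|
        ≤ ((d : ℝ) + 1) * ((1 / 2) * C' * zS * Zl (d + 1) (m / 2) * E) := by
    refine (Finset.abs_sum_le_sum_abs _ _).trans ?_
    refine (Finset.sum_le_sum fun κ _ => hHs κ).trans ?_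
    rw [Finset.sum_const, Finset.card_univ, Fintype.card_fin, nsmul_eq_mul]
    push_cast
    exact le_rfl
  have hsumM : |∑ ρ : Fin (d + 1), ∑' w : Site (d + 1),
      colM K' N ν y' ρ w * ((if y' = y then (1 / 2 : ℝ) else 0) - (if w = y then (1 / 2 : ℝ) else 0)) * ZM ρ w|
        ≤ ((d : ℝ) + 1) * ((1 / 2) * C' * zM * Zl (d + 1) (m / 2) * E) := by
    refine (Finset.abs_sum_le_sum_abs _ _).trans ?_
    refine (Finset.sum_le_sum fun ρ _ => hMs ρ).trans ?_
    rw [Finset.sum_const, Finset.card_univ, Fintype.card_fin, nsmul_eq_mul]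
    push_cast
    exact le_rfl
  rw [abs_mul, abs_of_pos (by norm_num : (0 : ℝ) < 1 / 2)]
  calc (1 / 2 : ℝ) * |_| ≤ (1 / 2) * (((d : ℝ) + 1) * ((1 / 2) * C' * zS * Zl (d + 1) (m / 2) * E)
        + ((d : ℝ) + 1) * ((1 / 2) * C' * zM * Zl (d + 1) (m / 2) * E)) :=
        mul_le_mul_of_nonneg_left ((abs_add_le _ _).trans (add_le_add hsumH hsumM)) (by norm_num)
    _ = (1 / 4) * ((d : ℝ) + 1) * C' * (zS + zM) * Zl (d + 1) (m / 2) * E := by ring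

end Generic

/-! ## §2b Bounded-weight pair charges of bi-localised kernels -/

/-- [folklore] **THE ω-CHARGE OF A BI-LOCALISED KERNEL IS BOUNDED**: `|Σ'_{(x,z)} ω(x,z)·K x z a b| ≤ Bω·C·Zl(δ)²` for `|ω| ≤ Bω`, `BiLoc K p q C δ`, `δ > 0`
(leaf-06's `GaugeReadChargeProfile.biLoc_weightMul` ⨾ `GaugeReadChargeDipole.abs_tsum_prod_le_of_biLoc`). -/
theorem abs_weightedCharge_le_of_biLoc {K : MKer (d + 1) (Fib d)} {p q : Site (d + 1)} {C δ : ℝ} (hK : BiLoc K p q C δ) (hδ : 0 < δ)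
    {ω : Site (d + 1) × Site (d + 1) → ℝ} {Bω : ℝ} (hω : ∀ xz, |ω xz| ≤ Bω) (a b : Fib d) :
    |∑' xz : Site (d + 1) × Site (d + 1), ω xz * K xz.1 xz.2 a b| ≤ Bω * C * (Zl (d + 1) δ * Zl (d + 1) δ) := by
  have h := abs_tsum_prod_le_of_biLoc (biLoc_weightMul hK hω) hδ a b
  simpa only [Prod.mk.eta] using h

/-- [folklore] Hence for a `LocStencil S Cs δs` family: `|Σ' ω·S κ u| ≤ Bω·Cs·Zl(δs)²` for every index `(κ, u)` — the `zS` of §2. -/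
theorem abs_weightedCharge_le_of_locStencil {S : Fin (d + 1) → Site (d + 1) → MKer (d + 1) (Fib d)} {Cs δs : ℝ} (hS : LocStencil S Cs δs)
    (hδs : 0 < δs) {ω : Site (d + 1) × Site (d + 1) → ℝ} {Bω : ℝ} (hω : ∀ xz, |ω xz| ≤ Bω) (κ : Fin (d + 1)) (u : Site (d + 1)) (a b : Fib d) :
    |∑' xz : Site (d + 1) × Site (d + 1), ω xz * S κ u xz.1 xz.2 a b| ≤ Bω * Cs * (Zl (d + 1) δs * Zl (d + 1) δs) :=
  abs_weightedCharge_le_of_biLoc (hS κ u) hδs hω a b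

/-- [folklore] And for a `VertexFamily M N CM δM` family: `|Σ' ω·M ρ w| ≤ Bω·CM·Zl(δM)²` for every index `(ρ, w)` — the `zM` of §2. -/
theorem abs_weightedCharge_le_of_vertexFamily {M : Fin (d + 1) → Site (d + 1) → MKer (d + 1) (Fib d)} {N : ℕ} {CM δM : ℝ}
    (hM : VertexFamily M N CM δM) (hδM : 0 < δM) {ω : Site (d + 1) × Site (d + 1) → ℝ} {Bω : ℝ} (hω : ∀ xz, |ω xz| ≤ Bω)
    (ρ : Fin (d + 1)) (w : Site (d + 1)) (a b : Fib d) :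
    |∑' xz : Site (d + 1) × Site (d + 1), ω xz * M ρ w xz.1 xz.2 a b| ≤ Bω * CM * (Zl (d + 1) δM * Zl (d + 1) δM) :=
  abs_weightedCharge_le_of_biLoc (hM ρ w) hδM hω a b

/-! ## §3 The comb shape: the envelope of the transported (α)-charge profile, hypotheses displayed -/

section Comb

variable {Lc : ℕ} [NeZero Lc]

/-- NOT IN PRINT; OUR BOOKKEEPING.  **THE TRANSPORTED (α)-CHARGE PROFILE HAS AN EXPONENTIAL ENVELOPE IN THE SLOT, ABOUT ITS LABEL** — the `hZ` binder of the (G) socket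
(`LayerFrozenLabel.abs_frozen_label_le`) for the (α)-piece, with the decay data of `G_{j+1} = coDressKBmAt ρ Lc (KInvStep Lc (j+1))`, `S_{j+1}`, `M1_{j+1}` as NAMED HYPOTHESES
(`hG`, `hS`, `hM1` — the tree supplies them per `j` by `decays_coDressKBmAt_KInvStep`, `locStencil_SpureRecAt`, `vertexFamily_M1At`; NO `j`-uniformity is claimed here): the value
`V y′` of `WardResidualRotatedVertexTransported.hasSum_prod_transported_rotatedVertex_comb` (label `y`, slot `(ν, y′)`, channel `(α, β)`, exit-face weight, scalar `−Lc²σ_{j+1}²`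
included) obeys `|V y′| ≤ Lc²σ_{j+1}²·¼(d+1)·CG·(Cs·Zl(δs)² + CM·Zl(δM)²)·Zl(δG∕2)·e^{−(δG∕2)‖y′ − y‖₁}` for EVERY `y′`. -/
theorem abs_transportedProfile_le (hLc : 1 ≤ Lc) (r : Fin (d + 1) → ℕ) (cE cVH cΛ : ℝ) (j : ℕ)
    {CG δG Cs δs CM δM : ℝ} (hCG : 0 ≤ CG) (hδG : 0 < δG) (hCs : 0 ≤ Cs) (hδs : 0 < δs) (hCM : 0 ≤ CM) (hδM : 0 < δM)
    (hG : Decays (coDressKBmAt (toSite r) Lc (KInvStep (d := d) Lc (j + 1))) CG δG)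
    (hS : LocStencil (SpureRecAt d Lc (toSite r) cE cVH cΛ (j + 1)) Cs δs)
    (hM1 : VertexFamily (M1At d Lc (toSite r) cΛ (j + 1)) Lc CM δM)
    (y : Site (d + 1)) (ν α β : Fin (d + 1)) (y' : Site (d + 1)) :
    |-((Lc : ℝ) ^ 2 * (((((Lc ^ (j + 1 + 1) : ℕ) : ℝ)) ^ (d + 1 + 1))⁻¹) ^ 2 *
        ((1 / 2 : ℝ) *
          ((∑ κ : Fin (d + 1), ∑' u : Site (d + 1),
              colH (coDressKBmAt (toSite r) Lc (KInvStep (d := d) Lc (j + 1))) Lc ν y' κ u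
                * ((if y' = y then (1 / 2 : ℝ) else 0) - (if blk Lc u = y then (1 / 2 : ℝ) else 0))
                * ∑' xz : Site (d + 1) × Site (d + 1),
                    (if xz.1 α % (Lc : ℤ) = (Lc : ℤ) - 1 ∧ xz.2 β % (Lc : ℤ) = (Lc : ℤ) - 1 then (1 : ℝ) else 0)
                      * SpureRecAt d Lc (toSite r) cE cVH cΛ (j + 1) κ u xz.1 xz.2 (Sum.inl α) (Sum.inl β))
            + ∑ ρ' : Fin (d + 1), ∑' w : Site (d + 1),
              colM (coDressKBmAt (toSite r) Lc (KInvStep (d := d) Lc (j + 1))) Lc ν y' ρ' w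
                * ((if y' = y then (1 / 2 : ℝ) else 0) - (if w = y then (1 / 2 : ℝ) else 0))
                * ∑' xz : Site (d + 1) × Site (d + 1),
                    (if xz.1 α % (Lc : ℤ) = (Lc : ℤ) - 1 ∧ xz.2 β % (Lc : ℤ) = (Lc : ℤ) - 1 then (1 : ℝ) else 0)
                      * M1At d Lc (toSite r) cΛ (j + 1) ρ' w xz.1 xz.2 (Sum.inl α) (Sum.inl β))))|
      ≤ ((Lc : ℝ) ^ 2 * (((((Lc ^ (j + 1 + 1) : ℕ) : ℝ)) ^ (d + 1 + 1))⁻¹) ^ 2)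
          * ((1 / 4) * ((d : ℝ) + 1) * CG * (Cs * (Zl (d + 1) δs * Zl (d + 1) δs) + CM * (Zl (d + 1) δM * Zl (d + 1) δM)) * Zl (d + 1) (δG / 2))
          * Real.exp (-(δG / 2) * l1 (y' - y)) := by
  classical
  have hω : ∀ xz : Site (d + 1) × Site (d + 1),
      |(if xz.1 α % (Lc : ℤ) = (Lc : ℤ) - 1 ∧ xz.2 β % (Lc : ℤ) = (Lc : ℤ) - 1 then (1 : ℝ) else 0)| ≤ 1 := fun xz => by
    split_ifs <;> simp
  have hZS : ∀ (κ : Fin (d + 1)) (u : Site (d + 1)), |∑' xz : Site (d + 1) × Site (d + 1),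
      (if xz.1 α % (Lc : ℤ) = (Lc : ℤ) - 1 ∧ xz.2 β % (Lc : ℤ) = (Lc : ℤ) - 1 then (1 : ℝ) else 0)
        * SpureRecAt d Lc (toSite r) cE cVH cΛ (j + 1) κ u xz.1 xz.2 (Sum.inl α) (Sum.inl β)| ≤ 1 * Cs * (Zl (d + 1) δs * Zl (d + 1) δs) :=
    fun κ u => abs_weightedCharge_le_of_locStencil hS hδs hω κ u (Sum.inl α) (Sum.inl β)
  have hZM : ∀ (ρ' : Fin (d + 1)) (w : Site (d + 1)), |∑' xz : Site (d + 1) × Site (d + 1),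
      (if xz.1 α % (Lc : ℤ) = (Lc : ℤ) - 1 ∧ xz.2 β % (Lc : ℤ) = (Lc : ℤ) - 1 then (1 : ℝ) else 0)
        * M1At d Lc (toSite r) cΛ (j + 1) ρ' w xz.1 xz.2 (Sum.inl α) (Sum.inl β)| ≤ 1 * CM * (Zl (d + 1) δM * Zl (d + 1) δM) :=
    fun ρ' w => abs_weightedCharge_le_of_vertexFamily hM1 hδM hω ρ' w (Sum.inl α) (Sum.inl β)
  have hz1 : 0 ≤ 1 * Cs * (Zl (d + 1) δs * Zl (d + 1) δs) := by
    have := Zl_nonneg (D := d + 1) hδs; positivity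
  have hz2 : 0 ≤ 1 * CM * (Zl (d + 1) δM * Zl (d + 1) δM) := by
    have := Zl_nonneg (D := d + 1) hδM; positivity
  have h := abs_slotProfile_le (K' := coDressKBmAt (toSite r) Lc (KInvStep (d := d) Lc (j + 1))) (N := Lc) hLc hδG hCG hz1 hz2 ν y y'
    (fun κ u => abs_colH_le (N := Lc) hG ν y' κ u) (fun ρ w => abs_colM_le (N := Lc) hG ν y' ρ w) hZS hZM
  have hs0 : (0 : ℝ) ≤ (Lc : ℝ) ^ 2 * (((((Lc ^ (j + 1 + 1) : ℕ) : ℝ)) ^ (d + 1 + 1))⁻¹) ^ 2 := by positivity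
  rw [abs_neg, abs_mul, abs_of_nonneg hs0]
  conv_rhs => rw [mul_assoc]
  exact mul_le_mul_of_nonneg_left (h.trans (le_of_eq (by ring))) hs0

/-- NOT IN PRINT; OUR BOOKKEEPING.  **EXISTENTIAL FORM, PER `j`** (the tree's decay lemmas instantiated: `decays_coDressKBmAt_KInvStep`, `locStencil_SpureRecAt`, `vertexFamily_M1At`):
for an in-block root, every level `j`, label `y`, slot direction `ν` and channel `(α, β)` there are `B ≥ 0` and `δZ > 0` with `|V y′| ≤ B·e^{−δZ‖y′ − y‖₁}` for all slots `y′` — the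
`hZ` binder of XREAD C-gan24leaf01-g65-1 (J1) for the (α)-piece.  (Constants depend on `j` here; the unit-currency, `j`-free version is the (S)-row assembly's.) -/
theorem exists_transportedProfile_envelope (hLc : 1 ≤ Lc) {r : Fin (d + 1) → ℕ} (hr : r ∈ box (d + 1) Lc) (cE cVH cΛ : ℝ) (j : ℕ)
    (y : Site (d + 1)) (ν α β : Fin (d + 1)) :
    ∃ B δZ : ℝ, 0 ≤ B ∧ 0 < δZ ∧ ∀ y' : Site (d + 1),
      |-((Lc : ℝ) ^ 2 * (((((Lc ^ (j + 1 + 1) : ℕ) : ℝ)) ^ (d + 1 + 1))⁻¹) ^ 2 *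
          ((1 / 2 : ℝ) *
            ((∑ κ : Fin (d + 1), ∑' u : Site (d + 1),
                colH (coDressKBmAt (toSite r) Lc (KInvStep (d := d) Lc (j + 1))) Lc ν y' κ u
                  * ((if y' = y then (1 / 2 : ℝ) else 0) - (if blk Lc u = y then (1 / 2 : ℝ) else 0))
                  * ∑' xz : Site (d + 1) × Site (d + 1),
                      (if xz.1 α % (Lc : ℤ) = (Lc : ℤ) - 1 ∧ xz.2 β % (Lc : ℤ) = (Lc : ℤ) - 1 then (1 : ℝ) else 0)
                        * SpureRecAt d Lc (toSite r) cE cVH cΛ (j + 1) κ u xz.1 xz.2 (Sum.inl α) (Sum.inl β))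
              + ∑ ρ' : Fin (d + 1), ∑' w : Site (d + 1),
                colM (coDressKBmAt (toSite r) Lc (KInvStep (d := d) Lc (j + 1))) Lc ν y' ρ' w
                  * ((if y' = y then (1 / 2 : ℝ) else 0) - (if w = y then (1 / 2 : ℝ) else 0))
                  * ∑' xz : Site (d + 1) × Site (d + 1),
                      (if xz.1 α % (Lc : ℤ) = (Lc : ℤ) - 1 ∧ xz.2 β % (Lc : ℤ) = (Lc : ℤ) - 1 then (1 : ℝ) else 0)
                        * M1At d Lc (toSite r) cΛ (j + 1) ρ' w xz.1 xz.2 (Sum.inl α) (Sum.inl β))))|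
        ≤ B * Real.exp (-δZ * l1 (y' - y)) := by
  obtain ⟨δG, CG, hδG, hCG, hG⟩ := decays_coDressKBmAt_KInvStep (d := d) hr (j + 1)
  obtain ⟨Cs, δs, hδs, hS⟩ := locStencil_SpureRecAt (d := d) (Lc := Lc) hLc hr cE cVH cΛ (j + 1)
  have hCs : 0 ≤ Cs := (hS 0 0).nonneg (Sum.inl 0)
  have hM1 := vertexFamily_M1At (d := d) hLc hr cΛ (j + 1) zero_le_one
  have hZ1 := Zl_nonneg (D := d + 1) hδs
  have hZ2 := Zl_nonneg (D := d + 1) (half_pos hδG)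
  have hZ3 := Zl_nonneg (D := d + 1) (one_pos (α := ℝ))
  exact ⟨_, δG / 2, by positivity, half_pos hδG, fun y' =>
    abs_transportedProfile_le hLc r cE cVH cΛ j hCG hδG hCs hδs (by positivity) one_pos hG hS hM1 y ν α β y'⟩

end Comb

end Summit.QuantumFields.BalabanUV.Beta.GAN24.SlotChargeProfileEnvelope

end
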